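import Mathlib.Tactic
import HarnessLib

/-!
# Kozma–Nitzan's Question 8 — UB(δ): the family reduction (all depths) and the depth-2 assembly (gen 45)

Support file (`--supports stmt-CriticalPhenomena-4575`, closed crux; independent mathematics on Kozma–Nitzan's Question 8,
arXiv:2401.12397 §5.5 p. 36), prover `prim-ineq-gen-6` (gen 45).  No definitions, no named facts, no sorries; standard axioms.
Memo `run/shared/lean/prim/prim-ineq-gen-6/PROOF-UBD2-G45.md`.

The two-level subtree bound UB(δ)_j is `δ_j ≤ c·μ̂^_j`, where the class values `δ` are given by the δ-RECURSION (gen 43)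
`δ_k = max (U_k) (ψ_k + Σ_{i<k} r_{i,k} δ_i)` with tree ratios `r ≥ 0`.  Unfolding the recursion, `δ_k` is ONE member of the finite
family `Λ^E_k := ψ_k + Σ_{i<k} r_{i,k}·(Λ^E_i if i ∈ E, U_i if i ∉ E)` (`E` = the set of Λ-classes), namely the member with
`E* = {i : δ_i ≠ U_i}`, unless `δ_k = U_k`.  Hence (`kUBd_of_family`): if `U_k ≤ cap_k` for all `k` (THEOREM UB, gen 28) and EVERY member
of the family satisfies `Λ^E_k ≤ cap_k`, then `δ_k ≤ cap_k` for all `k` — UB(δ) at every class follows from the `2^j` explicit hat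
inequalities per depth `j`.  At depth 2 these are the four shapes `E ∈ {∅, {0}, {1}, {0,1}}` (`kUBd2_cases`); each is settled in gen 45 by an
exact Bernstein certificate in the three-step model (THEOREM Ψ₂ for `E = {0,1}`, i.e. `Ψ̂₂`; structured certificates `Q^E = Q'' + ϖ·W`,
`W` manifestly nonnegative, for the other three), giving THEOREM UB(δ)₂.  The manifest nonnegativity of the `ϖ`-multiplier factors
`D^N_j = D − S_{j+1}a_jγ_jv_{j+1}` rests on the identities `kDN0_manifest`, `kDN1_manifest` (two-step model).
[cite: KozmaNitzan2024, Question 8 (§5.5 p. 36)]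
-/

namespace Summit.CriticalPhenomena.PercolationContinuityZ3.Theorems

namespace PocketCert

open Finset in
/-- **UB(δ) from the family (all depths).**  Let `δ_k = max (U_k) (ψ_k + Σ_{i<k} r_{i,k} δ_i)` and, for every selector `e : ℕ → Bool`,
`Λ^e_k = ψ_k + Σ_{i<k} r_{i,k}·(Λ^e_i if e i, U_i otherwise)`.  If `U_k ≤ cap_k` for all `k` and `Λ^e_k ≤ cap_k` for all `e, k`,
then `δ_k ≤ cap_k` for all `k`.  [cite: KozmaNitzan2024, Question 8 (§5.5 p. 36)] -/
theorem kUBd_of_family (U ψ cap δ : ℕ → ℝ) (r : ℕ → ℕ → ℝ) (Λ : (ℕ → Bool) → ℕ → ℝ)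
    (hδ : ∀ k, δ k = max (U k) (ψ k + ∑ i ∈ range k, r i k * δ i))
    (hΛ : ∀ e k, Λ e k = ψ k + ∑ i ∈ range k, r i k * (if e i then Λ e i else U i))
    (hU : ∀ k, U k ≤ cap k) (hfam : ∀ e k, Λ e k ≤ cap k) :
    ∀ k, δ k ≤ cap k := by
  -- the selector of Λ-classes
  set e : ℕ → Bool := fun i => decide (δ i ≠ U i) with he
  -- key claim: Λ^e reproduces the Λ-branch of δ at every class, and δ itself at the Λ-classes
  have key : ∀ k, ψ k + ∑ i ∈ range k, r i k * δ i = Λ e k := by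
    intro k
    induction k using Nat.strong_induction_on with
    | _ k ih =>
      rw [hΛ e k]
      congr 1
      apply sum_congr rfl
      intro i hi
      have hik : i < k := mem_range.mp hi
      congr 1
      by_cases h : δ i = U i
      · have : e i = false := by simp [he, h]
        simp [this, h]
      · have : e i = true := by simp [he, h]
        simp only [this, if_true]
        -- δ i ≠ U i forces the Λ-branch: δ i = ψ i + Σ … = Λ e i
        have hmax := hδ i
        have hbr : δ i = ψ i + ∑ i' ∈ range i, r i' i * δ i' := by
          rcases max_choice (U i) (ψ i + ∑ i' ∈ range i, r i' i * δ i') with h1 | h2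
          · exact absurd (hmax.trans h1) h
          · exact hmax.trans h2
        rw [hbr]; exact ih i hik
  intro k
  rw [hδ k]
  apply max_le (hU k)
  rw [key k]; exact hfam e k

/-- **UB(δ)₂ from the four depth-2 shapes.**  With `δ₀ = max U₀ ψ₀`, `δ₁ = max U₁ (ψ₁ + r₀₁δ₀)`, `δ₂ = max U₂ (ψ₂ + r₀₂δ₀ + r₁₂δ₁)`,
and the five bounds `U₂ ≤ cap` (THEOREM UB), `Ψ̂₂ = ψ₂ + r₀₂ψ₀ + r₁₂(ψ₁ + r₀₁ψ₀) ≤ cap` (THEOREM Ψ₂ chain, `E = {0,1}`),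
`ψ₂ + r₀₂U₀ + r₁₂U₁ ≤ cap` (`E = ∅`, THEOREM X₂), `ψ₂ + r₀₂U₀ + r₁₂(ψ₁ + r₀₁U₀) ≤ cap` (`E = {1}`), `ψ₂ + r₀₂ψ₀ + r₁₂U₁ ≤ cap` (`E = {0}`):
`δ₂ ≤ cap`.  [cite: KozmaNitzan2024, Question 8 (§5.5 p. 36)] -/
theorem kUBd2_cases (U0 U1 U2 ψ0 ψ1 ψ2 r01 r02 r12 δ0 δ1 δ2 cap : ℝ)
    (hδ0 : δ0 = max U0 ψ0) (hδ1 : δ1 = max U1 (ψ1 + r01 * δ0)) (hδ2 : δ2 = max U2 (ψ2 + r02 * δ0 + r12 * δ1))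
    (hU2 : U2 ≤ cap)
    (h01 : ψ2 + r02 * ψ0 + r12 * (ψ1 + r01 * ψ0) ≤ cap) (hE : ψ2 + r02 * U0 + r12 * U1 ≤ cap)
    (h1 : ψ2 + r02 * U0 + r12 * (ψ1 + r01 * U0) ≤ cap) (h0 : ψ2 + r02 * ψ0 + r12 * U1 ≤ cap) :
    δ2 ≤ cap := by
  rw [hδ2]
  apply max_le hU2
  rcases max_choice U0 ψ0 with e0 | e0 <;> rcases max_choice U1 (ψ1 + r01 * δ0) with e1 | e1 <;>
    rw [hδ1, e1] <;> rw [hδ0, e0] <;> first | exact hE | exact h1 | exact h0 | exact h01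

/-- **Manifest form of `D^N₀`** (two-step model, root marks `(a,g)`, first edge `s`, `T₁` channels `(u₁,v₁,m₁)`, `p₀ = u₁+v₁+m₁`):
`D − s·a·g·v₁ = a(1−g)(p₀ − s u₁) = (1−s)·p₀·a(1−g) + s·a(1−g)·(v₁+m₁)` (the `ϖ`-multiplier factor of the depth-0 T4-share is a sum of
products of nonnegatives).  [cite: KozmaNitzan2024, Question 8 (§5.5 p. 36)] -/
theorem kDN0_manifest (a g s u1 v1 m1 p0 D : ℝ) (hp0 : p0 = u1 + v1 + m1)
    (hD : D = a * (p0 - s * u1) - a * g * (p0 - s * (u1 + v1))) :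
    D - s * a * g * v1 = (1 - s) * p0 * (a * (1 - g)) + s * (a * (1 - g)) * (v1 + m1) := by
  subst hD; rw [hp0]; ring

/-- **Manifest form of `D^N₁`** (two-step model `b₀(a,g) –s– b₁(A,C) –t– T₂(u₂,v₂,m₂)`, `a₁ = aA`, `γ₁ = gC`):
`D − s t·a₁γ₁·v₂ = (1−s)p₀·a(1−g) + s(1−t)p₁·a₁(1−γ₁) + s t·a₁(1−γ₁)·(v₂+m₂)`.  [cite: KozmaNitzan2024, Question 8 (§5.5 p. 36)] -/
theorem kDN1_manifest (a g s A C t u2 v2 m2 p1 mt u1 v1 m1 p0 D : ℝ) (hp1 : p1 = u2 + v2 + m2)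
    (hmt : mt = (1 - t) * p1 + t * m2) (hu1 : u1 = C * (1 - A) * mt + t * C * u2) (hv1 : v1 = A * (1 - C) * mt + t * A * v2)
    (hm1 : m1 = A * C * mt) (hp0 : p0 = u1 + v1 + m1) (hD : D = a * (p0 - s * u1) - a * g * (p0 - s * (u1 + v1))) :
    D - s * t * (a * A) * (g * C) * v2
      = (1 - s) * p0 * (a * (1 - g)) + s * (1 - t) * p1 * ((a * A) * (1 - g * C)) + s * t * ((a * A) * (1 - g * C)) * (v2 + m2) := by
  subst hD hp0 hm1 hv1 hu1; rw [hmt, hp1]; ring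

end PocketCert

end Summit.CriticalPhenomena.PercolationContinuityZ3.Theorems
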